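import Mathlib
import HarnessLib
import Summits.HubbardSuperconductivity.HubbardSuperconductivity.Theorems.KLProgrammeKLRegimeSplitTwoLegSizesMSChainFrames
import Summits.HubbardSuperconductivity.HubbardSuperconductivity.Theorems.KLProgrammeKLRegimeCountertermJacksonLowBernstein

/-!
# Route `KLProgramme`, crux K3 — gen-5 ENGINE child (stmt-…-19918, `stub_twoLeg_step`, clause `TwoLegSizesMST`), recipe (L)+(F):
# SIZES OF THE LOW AND HIGH PARTS OF A FRAME PIECE ((P4-c), step 1: the inputs of the chain frames' towers)

Seat hubbard-kl-k3c3-p1 (g3).  For a frame piece `P : TrigPolyC4v` with `‖Dʲ evalM P‖ ≤ a j` (`j ≤ 4`, FrameOK (ii)'s shape) the anchored piece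
`P° = P − P(0)` has sizes `B 0 = 2·a 0`, `B j = a j` (`j ≥ 1`); hence (all on `Momentum`, uniformly):
* `norm_iteratedFDeriv_evalM_highPart_le`: `‖Dʲ evalM (highPart d P)‖ ≤ 4·B j` (contraction) and the Jackson gains
  `≤ 2π⁶/(d+1)·B (j+1)`, `≤ 4π⁷/(d+1)²·B (j+2)`, `≤ 2π¹³/(d+1)³·B (j+3)`, `≤ 4π¹⁴/(d+1)⁴·B (j+4)` (`…JacksonHighPart`);
* `norm_iteratedFDeriv_evalM_lowPart_le`: `‖Dʲ evalM (lowPart d P)‖ ≤ 3·B j` (contraction) AND the sup-amplitude Bernstein bound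
  `≤ 24(2d+1)(1+4d)ʲ·a 0` (`…JacksonLowBernstein`) — the form that keeps the BASE frame's towers scale-`n` graded.
Proofs only; nothing about the model.
-/

noncomputable section

namespace Summit.HubbardSuperconductivity.HubbardSuperconductivity.Theorems.KLRegimeSplit

set_option linter.dupNamespace false -- summit = problem name (single-conjunct summit), D-0017

open Real Finset Literature.MathematicalPhysics.QuantumLattice

section Parts

variable (d : ℕ) {P : TrigPolyC4v} {a : ℕ → ℝ}

/-- The anchored piece's size package: `B 0 = 2·a 0`, `B j = a j` (`j ≥ 1`). -/
def anchorSize (a : ℕ → ℝ) (j : ℕ) : ℝ := if j = 0 then 2 * a 0 else a j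

/-- The anchored piece read on `Momentum` is `evalM P` minus a constant. -/
theorem onM_msAnchor_eq (P : TrigPolyC4v) :
    (fun q : EuclideanSpace ℝ (Fin 2) => (msAnchor P).eval (WithLp.ofLp q)) = fun q => evalM P q - P.eval 0 := by
  funext q; simp [eval_msAnchor, evalM]

/-- The anchored piece is `C^∞` on `Momentum`. -/
theorem contDiff_onM_msAnchor (P : TrigPolyC4v) {m : ℕ} :
    ContDiff ℝ m (fun q : EuclideanSpace ℝ (Fin 2) => (msAnchor P).eval (WithLp.ofLp q)) := by
  rw [onM_msAnchor_eq]; exact (contDiff_evalM P).sub contDiff_const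

/-- **Sizes of the anchored piece**: `‖Dʲ(P° ∘ ofLp)‖ ≤ anchorSize a j` from `‖Dʲ evalM P‖ ≤ a j`. -/
theorem norm_iteratedFDeriv_onM_msAnchor_le (ha : ∀ j ≤ 4, ∀ q : Momentum, ‖iteratedFDeriv ℝ j (evalM P) q‖ ≤ a j)
    {j : ℕ} (hj : j ≤ 4) (q : Momentum) :
    ‖iteratedFDeriv ℝ j (fun q : EuclideanSpace ℝ (Fin 2) => (msAnchor P).eval (WithLp.ofLp q)) q‖ ≤ anchorSize a j := by
  rw [onM_msAnchor_eq]
  rcases Nat.eq_zero_or_pos j with rfl | hjpos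
  · simp only [anchorSize, if_true, norm_iteratedFDeriv_zero, Real.norm_eq_abs]
    have h0 := ha 0 (by norm_num) q
    have h00 := ha 0 (by norm_num) (WithLp.toLp 2 (0 : Fin 2 → ℝ))
    rw [norm_iteratedFDeriv_zero, Real.norm_eq_abs] at h0 h00
    have e : evalM P (WithLp.toLp 2 (0 : Fin 2 → ℝ)) = P.eval 0 := by simp [evalM]
    rw [e] at h00
    calc |evalM P q - P.eval 0| ≤ |evalM P q| + |P.eval 0| := abs_sub _ _
      _ ≤ a 0 + a 0 := add_le_add h0 h00
      _ = 2 * a 0 := by ring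
  · have hne : j ≠ 0 := by omega
    simp only [anchorSize, if_neg hne]
    rw [fun_iteratedFDeriv_sub_apply ((contDiff_evalM P).contDiffAt) contDiffAt_const, iteratedFDeriv_const_of_ne hne, Pi.zero_apply,
      sub_zero]
    exact ha j hj q

/-- **SIZES OF THE HIGH PART**: contraction `4·anchorSize a j` and the four Jackson gains. -/
theorem norm_iteratedFDeriv_evalM_highPart_le (ha : ∀ j ≤ 4, ∀ q : Momentum, ‖iteratedFDeriv ℝ j (evalM P) q‖ ≤ a j) :
    (∀ j ≤ 4, ∀ q : Momentum, ‖iteratedFDeriv ℝ j (evalM (highPart d P)) q‖ ≤ 4 * anchorSize a j) ∧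
    (∀ j, j + 1 ≤ 4 → ∀ q : Momentum, ‖iteratedFDeriv ℝ j (evalM (highPart d P)) q‖ ≤ 2 * π ^ 6 / (d + 1) * anchorSize a (j + 1)) ∧
    (∀ j, j + 2 ≤ 4 → ∀ q : Momentum, ‖iteratedFDeriv ℝ j (evalM (highPart d P)) q‖ ≤ 4 * π ^ 7 / (d + 1) ^ 2 * anchorSize a (j + 2)) ∧
    (∀ j, j + 3 ≤ 4 → ∀ q : Momentum, ‖iteratedFDeriv ℝ j (evalM (highPart d P)) q‖ ≤ 2 * π ^ 13 / (d + 1) ^ 3 * anchorSize a (j + 3)) ∧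
    (∀ j, j + 4 ≤ 4 → ∀ q : Momentum, ‖iteratedFDeriv ℝ j (evalM (highPart d P)) q‖ ≤ 4 * π ^ 14 / (d + 1) ^ 4 * anchorSize a (j + 4)) := by
  have hF : Continuous (msAnchor P).eval := continuous_trigPoly_eval _
  obtain ⟨_, _, h0, h1, h2, h3, h4⟩ := jhigh_package d hF (m := 4) (contDiff_onM_msAnchor P)
    (B := anchorSize a) (fun i hi x => norm_iteratedFDeriv_onM_msAnchor_le ha hi x)
  have hfun : evalM (highPart d P) = fun q : EuclideanSpace ℝ (Fin 2) => jhigh d (msAnchor P).eval (WithLp.ofLp q) := by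
    funext q; simp [evalM, eval_highPart]
  rw [hfun]
  exact ⟨h0, h1, h2, h3, h4⟩

/-- **SIZES OF THE LOW PART, contraction form**: `‖Dʲ evalM (lowPart d P)‖ ≤ 3·anchorSize a j`. -/
theorem norm_iteratedFDeriv_evalM_lowPart_le (ha : ∀ j ≤ 4, ∀ q : Momentum, ‖iteratedFDeriv ℝ j (evalM P) q‖ ≤ a j)
    {j : ℕ} (hj : j ≤ 4) (q : Momentum) : ‖iteratedFDeriv ℝ j (evalM (lowPart d P)) q‖ ≤ 3 * anchorSize a j := by
  have hF : Continuous (msAnchor P).eval := continuous_trigPoly_eval _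
  obtain ⟨hPc, hPC, hPb, _⟩ := jsmooth_package d hF (m := 4) (contDiff_onM_msAnchor P) (B := anchorSize a)
    (fun i hi x => norm_iteratedFDeriv_onM_msAnchor_le ha hi x)
  obtain ⟨_, hPPC, hPPb, _⟩ := jsmooth_package d hPc (m := 4) hPC (B := anchorSize a) hPb
  have hfun : evalM (lowPart d P) = (fun q : EuclideanSpace ℝ (Fin 2) => (2 : ℝ) • jsmooth d (msAnchor P).eval (WithLp.ofLp q)) -
      fun q => jsmooth d (jsmooth d (msAnchor P).eval) (WithLp.ofLp q) := by
    funext q; simp [evalM, eval_lowPart, jlow_apply, smul_eq_mul]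
  rw [hfun, iteratedFDeriv_sub_apply (((hPC.of_le (by exact_mod_cast hj)).const_smul (2 : ℝ)).contDiffAt)
    ((hPPC.of_le (by exact_mod_cast hj)).contDiffAt), iteratedFDeriv_const_smul_apply' ((hPC.of_le (by exact_mod_cast hj)).contDiffAt)]
  calc ‖(2 : ℝ) • iteratedFDeriv ℝ j (fun q : EuclideanSpace ℝ (Fin 2) => jsmooth d (msAnchor P).eval (WithLp.ofLp q)) q -
        iteratedFDeriv ℝ j (fun q => jsmooth d (jsmooth d (msAnchor P).eval) (WithLp.ofLp q)) q‖
      ≤ ‖(2 : ℝ) • iteratedFDeriv ℝ j (fun q : EuclideanSpace ℝ (Fin 2) => jsmooth d (msAnchor P).eval (WithLp.ofLp q)) q‖ +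
        ‖iteratedFDeriv ℝ j (fun q => jsmooth d (jsmooth d (msAnchor P).eval) (WithLp.ofLp q)) q‖ := norm_sub_le _ _
    _ ≤ 2 * anchorSize a j + anchorSize a j := by
        rw [norm_smul, Real.norm_eq_abs, abs_two]
        exact add_le_add (mul_le_mul_of_nonneg_left (hPb j hj q) (by norm_num)) (hPPb j hj q)
    _ = 3 * anchorSize a j := by ring

/-- **SIZES OF THE LOW PART, Bernstein form**: `‖Dʲ evalM (lowPart d P)‖ ≤ 24(2d+1)(1+4d)ʲ·a 0` for EVERY `j` — amplitude = the piece's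
SUP bound `a 0`, each derivative costs `≤ 1 + 4d`: this is the form under which the low parts of the deep pieces, merged into the base frame,
keep its towers scale-`n` graded (`d = 4ⁿ`). -/
theorem norm_iteratedFDeriv_evalM_lowPart_le_bernstein (ha0 : ∀ q : Momentum, ‖iteratedFDeriv ℝ 0 (evalM P) q‖ ≤ a 0)
    (j : ℕ) (q : Momentum) : ‖iteratedFDeriv ℝ j (evalM (lowPart d P)) q‖ ≤ 24 * (2 * d + 1) * (1 + 4 * d) ^ j * a 0 := by
  have hs := isSymmetricFrame_eval (msAnchor P)
  have hA : ∀ p, |(msAnchor P).eval p| ≤ 2 * a 0 := by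
    intro p
    have h0 := ha0 (WithLp.toLp 2 p)
    have h00 := ha0 (WithLp.toLp 2 (0 : Fin 2 → ℝ))
    rw [norm_iteratedFDeriv_zero, Real.norm_eq_abs] at h0 h00
    simp only [evalM] at h0 h00
    rw [eval_msAnchor]
    calc |P.eval p - P.eval 0| ≤ |P.eval p| + |P.eval 0| := abs_sub _ _
      _ ≤ a 0 + a 0 := add_le_add h0 h00
      _ = 2 * a 0 := by ring
  have hfun : evalM (lowPart d P) = fun q : Momentum => jlow d (msAnchor P).eval (WithLp.ofLp q) := by
    funext q; simp [evalM, eval_lowPart]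
  rw [hfun]
  calc _ ≤ 12 * (2 * d + 1) * (1 + 4 * d) ^ j * (2 * a 0) :=
        norm_iteratedFDeriv_jlow_le d (continuous_trigPoly_eval _) hs.1 hs.2.1 hs.2.2 hA j q
    _ = 24 * (2 * d + 1) * (1 + 4 * d) ^ j * a 0 := by ring

end Parts

end Summit.HubbardSuperconductivity.HubbardSuperconductivity.Theorems.KLRegimeSplit

end
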